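/-
Copyright: the b2b-balaban T⁴-continuum CRUX team, row NE7b OWNER lineage `t4-ne7b-p1` (gen 138). Project licence.
-/
import Mathlib.Analysis.SpecificLimits.Basic
import Mathlib.Tactic.Linarith
import Mathlib.Tactic.Positivity
import Mathlib.Tactic.Ring

/-!
# THE FIXED-BALL TEST OF THE COMBINED LETTER MAP (fluctuation (427) ∘ rescaling (428)+(429)) — AN HONEST **NO** AT CANONICAL SCALING,
# AND EXACTLY WHERE A YES WOULD LIVE.  The nine letters of the `Y`-local block class move in one renormalisation step by
#   FLUCTUATION (427):  `(κ₀,κ₁,a,κ₂,κ₃,κu,au,Λ,λ) ↦ (λ+Λ∕2, 2λ+Λ, 1, 2(2λ+Λ), κ₃⁺, λ+Λ∕2, 0, Λ+2λ, 2λ+Λ)`,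
#   RESCALING (428):    `(κ₀,κ₁,a,κ₂,κ₃,κu,au,Λ,λ) ↦ (cκ₀, ‖A‖κ₁max(1,c), a, ‖A‖²κ₂, ‖A‖³κ₃, κu·max(1,c), au, cΛ, ‖A‖²λ)`,
# so the pair `(λ, Λ)` (secant-lower and two-point-upper letters) is a CLOSED LINEAR SUBSYSTEM: `λ_{k+1} = a(2λ_k+Λ_k)`, `Λ_{k+1} =
# c(Λ_k+2λ_k)` with `a = ‖A‖²`, `c` = the block transfer constant — and every other letter of step `k+1` is a function of `(λ_k, Λ_k)`
# (and `κ₃_k`, `m_k`).  Its core `S_k := 2λ_k + Λ_k` obeys `S_{k+1} = (2a+c)·S_k` EXACTLY, so `S_k = (2a+c)^k·S_0`: the letters stay in a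
# ball iff `2a + c ≤ 1`, blow up iff `2a + c > 1` (`S_0 > 0`).  At the CANONICAL exponents of (429) `a ≤ c = t²n = L²` with `c = L² ≥ 1`
# already: `2a + c ≥ L² ≥ 1`, and `> 1` for every `L > 1` — NO INVARIANT BALL; the quadratic letters are MASS-TYPE RELEVANT and the
# format loses a further factor `3` per step (SCOPING (d9)(2); row NE7b, node U5c; Mathlib only; [folklore] real sequences)

Cell `pub-balaban`, sub-cell `t4`, spine estimate NE7b (`T4WeightBudget.RelWeightBound`; the cell's OWN estimate — NOT PRINTED in
[Bałaban 1983–89], NOT PROVED).  Crux-route work under `Spine/NE7b/` by the row OWNER (`t4-ne7b-p1` gen 138, file (430)) under FREEZE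
(0)'s crux-prover clause; NOTHING of Bałaban's is named as a Lean object, valued or asserted; no `T4Continuum/Support` leaf typed; no
`def`, no notation; zero `sorry`.  Imports: Mathlib only (fast lane); (427), (428), (429) are met BY SHAPE: the recursion hypotheses
`hlam`, `hLam` below ARE (427)'s `output_secant_letter`∕`output_upper_letter` (`λ⁺ = 2λ+Λ`, `Λ⁺ = Λ+2λ`) followed by (428)'s
`secant_letter_comp`∕`upper_letter_comp` (`× ‖A‖²`, `× c`), and §5's `a ≤ L²`, `c = L²` are (429)'s `norm_sq_smul_blockInj_le`,
`blockTransfer_eq` at `canonical_quadratic_factor`.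

WHY (SCOPING-d9 (2), memo `t4/b2b-balaban-t4-ne7b-p1/g137/records/SCOPING-d9-class-closure.md`: «find the parameter region (if any)
where the combined map sends a ball of letters into itself — an honest NO is as valuable as a YES (it prices (β4))»).  THE ANSWER, typed:
(i) the test is decided by the two quadratic two-point letters alone, through the scalar `2‖A‖² + c`; (ii) NO whenever `2‖A‖² + c > 1`,
in particular at canonical scaling in every dimension (`c = L²`); YES (a bounded, indeed contracting, quadratic core) iff `2‖A‖² + c ≤ 1`
(`< 1`), a region the canonical rescaling never meets; (iii) the field normalisation `t` does NOT rescue it: the regulator of the next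
step reads the product (quadratic letter) × (next covariance bound), in which `t` cancels (§6) — what grows is the dimensionless mass-type
combination, by `L²` per step (relevance) times the format's own loss (`3`: the fluctuation bound `(w⁺)″ ∈ [−(2λ+Λ), 2λ+Λ]` measures the
OSCILLATION of `HessW`, so even with no blocking, `L = 1`, `a = c = 1`, two half-steps cost `3×` one full step — the letter format is
not a semigroup).  WHAT A YES NEEDS (located, not typed; this is (β4) proper): the quadratic letters of the extracted output must be
DERIVED quantities `≈ κ₃·R` on a small-field ball of radius `R` (Taylor-2 extraction at the background already gives `(w⁺)″(0) = 0`,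
(415)∕(416)), the cubic from a quartic letter `κ₄·R` with the odd part killed by symmetry or extracted, the quartic MARGINAL only in a
format that sees the locality of `U` inside its block (power counting `L^{d−k[φ]}`: `L², L, 1` for `k = 2,3,4` at `d = 4`, against the
operator-norm transport's `‖A‖^k = L^k` of (428)), and the fields beyond `R` paid by large-field suppression — i.e. a `(κ₄, R)`-class
with relevant parts renormalised, not a nine-sup-letter class.  That is Bałaban's ∕ Gawędzki–Kupiainen's small-field∕large-field
machinery; its absence is now a typed obstruction, not an opinion.

WHAT IS PROVED ([folklore]; `lam Lam : ℕ → ℝ` any sequences obeying the combined recursion with factors `a, c : ℝ`):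
* §1 `core_succ` (`2λ_{k+1}+Λ_{k+1} = (2a+c)(2λ_k+Λ_k)`), `core_closed_form` (`= (2a+c)^k(2λ_0+Λ_0)`), `letters_nonneg`, `succ_eq_factor_mul_core`
  (`λ_{k+1} = a·S_k`, `Λ_{k+1} = c·S_k`).
* §2 **NO**: `core_unbounded` (`a, c ≥ 0`, `2a+c > 1`, `S_0 > 0 ⟹ ∀ B ∃ k, S_k > B`), **`no_invariant_ball`** (`¬ ∃ B, ∀ k, λ_k ≤ B ∧ Λ_k ≤ B`),
  `box_escapes_in_one_step` (the image of the box `[0,r]²` contains `(3ar, 3cr)`: not inside the box once `3a > 1` or `3c > 1`).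
* §3 **THE YES-REGION**: `core_le_of_factor_le_one` (`2a+c ≤ 1 ⟹ S_k ≤ S_0`), `letters_bounded_of_factor_le_one` (`λ_k ≤ max(λ_0, aS_0)`,
  `Λ_k ≤ max(Λ_0, cS_0)` — an invariant ball), `core_tendsto_zero` (`2a+c < 1 ⟹ S_k → 0`), `additive_letter_bounded` (the `κ₃`-type recursion
  `x_{k+1} ≤ θ(x_k + q_k)`, `θ ≤ 1`, `x, q ≥ 0 ⟹ x_k ≤ x_0 + Σ_{j<k} q_j`).
* §4 **CANONICAL VERDICT**: `canonical_factor_gt_one` (`0 ≤ a`, `c = L²`, `1 < L ⟹ 1 < 2a+c`), **`canonical_no_invariant_ball`** (the recursion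
  with `0 ≤ a`, `c = L²`, `L > 1`, `λ_0, Λ_0 ≥ 0`, `2λ_0+Λ_0 > 0` admits no ball), `format_loss_without_blocking` (`a = c = 1 ⟹ S_k = 3^k S_0`).
* §5 `yes_region_excludes_canonical` (`2a + c ≤ 1 ⟹ c ≤ 1`, so `c = L²` forces `L ≤ 1`: no coarse-graining).
* §6 `regulator_product_t_free` (`t ≠ 0 ⟹ (t²n·x)·(γ∕t²) = n·x·γ`: the field normalisation cancels in the next regulator).
* §7 toy (kernel): `L = 2`, `a = c = 4`: `S_1 = 12·S_0`.

HONEST (what this is NOT).  A verdict on the owner's LETTER FORMAT, not on Bałaban: it says the nine-sup-letter class of (399)–(427)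
cannot be iterated through a coarse-graining at canonical scaling, and names the format that could ((κ₄, R)-class + extraction +
large-field suppression = (β4) ∧ (β3′), NOT typed).  The next covariance's actual bound (which fixes `a, c` in regulator units beyond
the canonical power `L²`) is model input ((A3) ∕ (A1c), NC-NE7b-α UNRULED).  Nothing of Bałaban's asserted; BY-NAME EFFECT ON THE WALL:
NONE.  NE7b NOT PRINTED ∕ NOT PROVED; spine PROVED 0∕9; rung (B)+1 — the programme's measures remain FINITE-torus statements; NOT the
mass gap, NOT Clay.  HONEST DEPENDENCY: continuum YM on T⁴ ⇐ BetaPertH ∧ nine spine estimates (0∕9 proved); BetaPertH ⇐ (D1) ∧ (D4) ∧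
CAP+tail; G-an2-4 gates asym, D1 and NE2∕3∕4.
-/

set_option autoImplicit false

namespace Summit.QuantumFields.BalabanUV.T4Continuum.NE7b.SupBlockLetterMapFixedBall

open Filter Topology Finset
open scoped BigOperators

variable {lam Lam : ℕ → ℝ} {a c : ℝ}

/-! ## §1. The closed quadratic core of the combined letter map -/

/-- **THE CORE RECURSION**: `2λ_{k+1} + Λ_{k+1} = (2a + c)·(2λ_k + Λ_k)` — exact, for the combined map
`λ_{k+1} = a(2λ_k+Λ_k)`, `Λ_{k+1} = c(Λ_k+2λ_k)`. [folklore] -/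
theorem core_succ (hlam : ∀ k, lam (k + 1) = a * (2 * lam k + Lam k)) (hLam : ∀ k, Lam (k + 1) = c * (Lam k + 2 * lam k)) (k : ℕ) :
    2 * lam (k + 1) + Lam (k + 1) = (2 * a + c) * (2 * lam k + Lam k) := by
  rw [hlam k, hLam k]; ring

/-- **CLOSED FORM**: `2λ_k + Λ_k = (2a + c)^k·(2λ_0 + Λ_0)`. [folklore] -/
theorem core_closed_form (hlam : ∀ k, lam (k + 1) = a * (2 * lam k + Lam k)) (hLam : ∀ k, Lam (k + 1) = c * (Lam k + 2 * lam k)) :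
    ∀ k : ℕ, 2 * lam k + Lam k = (2 * a + c) ^ k * (2 * lam 0 + Lam 0) := by
  intro k
  induction k with
  | zero => simp
  | succ k ih => rw [core_succ hlam hLam k, ih, pow_succ]; ring

/-- The next letters are the core times the factors: `λ_{k+1} = a·S_k`, `Λ_{k+1} = c·S_k`. [folklore] -/
theorem succ_eq_factor_mul_core (hlam : ∀ k, lam (k + 1) = a * (2 * lam k + Lam k)) (hLam : ∀ k, Lam (k + 1) = c * (Lam k + 2 * lam k))
    (k : ℕ) : lam (k + 1) = a * (2 * lam k + Lam k) ∧ Lam (k + 1) = c * (2 * lam k + Lam k) := by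
  refine ⟨hlam k, ?_⟩
  rw [hLam k]; ring

/-- Nonnegative factors and nonnegative initial letters keep every letter nonnegative. [folklore] -/
theorem letters_nonneg (hlam : ∀ k, lam (k + 1) = a * (2 * lam k + Lam k)) (hLam : ∀ k, Lam (k + 1) = c * (Lam k + 2 * lam k))
    (ha : 0 ≤ a) (hc : 0 ≤ c) (h0 : 0 ≤ lam 0) (h0' : 0 ≤ Lam 0) : ∀ k : ℕ, 0 ≤ lam k ∧ 0 ≤ Lam k := by
  intro k
  induction k with
  | zero => exact ⟨h0, h0'⟩
  | succ k ih =>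
    refine ⟨?_, ?_⟩
    · rw [hlam k]; exact mul_nonneg ha (by linarith [ih.1, ih.2])
    · rw [hLam k]; exact mul_nonneg hc (by linarith [ih.1, ih.2])

/-! ## §2. NO: above the threshold the letters leave every ball -/

/-- **THE CORE IS UNBOUNDED ABOVE THE THRESHOLD**: `2a + c > 1` and `2λ_0 + Λ_0 > 0` give `∀ B, ∃ k, B < 2λ_k + Λ_k`. [folklore] -/
theorem core_unbounded (hlam : ∀ k, lam (k + 1) = a * (2 * lam k + Lam k)) (hLam : ∀ k, Lam (k + 1) = c * (Lam k + 2 * lam k))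
    (hρ : 1 < 2 * a + c) (hS0 : 0 < 2 * lam 0 + Lam 0) : ∀ B : ℝ, ∃ k : ℕ, B < 2 * lam k + Lam k := by
  intro B
  have ht : Tendsto (fun k : ℕ => (2 * a + c) ^ k * (2 * lam 0 + Lam 0)) atTop atTop :=
    (tendsto_pow_atTop_atTop_of_one_lt hρ).atTop_mul_const hS0
  obtain ⟨k, hk⟩ := (ht.eventually_gt_atTop B).exists
  exact ⟨k, by rw [core_closed_form hlam hLam k]; exact hk⟩

/-- **NO INVARIANT BALL ABOVE THE THRESHOLD**: with `2a + c > 1` and `2λ_0 + Λ_0 > 0`, no `B` bounds both letters along the flow. [folklore] -/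
theorem no_invariant_ball (hlam : ∀ k, lam (k + 1) = a * (2 * lam k + Lam k)) (hLam : ∀ k, Lam (k + 1) = c * (Lam k + 2 * lam k))
    (hρ : 1 < 2 * a + c) (hS0 : 0 < 2 * lam 0 + Lam 0) : ¬ ∃ B : ℝ, ∀ k : ℕ, lam k ≤ B ∧ Lam k ≤ B := by
  rintro ⟨B, hB⟩
  obtain ⟨k, hk⟩ := core_unbounded hlam hLam hρ hS0 (3 * B)
  have h1 := (hB k).1
  have h2 := (hB k).2
  linarith

/-- **THE BOX ESCAPES IN ONE STEP**: the corner `(r, r)` of the box `[0,r]²` is sent to `(3ar, 3cr)`; if `3a > 1` (or `3c > 1`) and `r > 0`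
this is outside the box — no box `[0,r]²` with `r > 0` is mapped into itself. [folklore] -/
theorem box_escapes_in_one_step {r : ℝ} (hr : 0 < r) (h3 : 1 < 3 * a ∨ 1 < 3 * c) :
    ¬ (a * (2 * r + r) ≤ r ∧ c * (r + 2 * r) ≤ r) := by
  rintro ⟨h1, h2⟩
  rcases h3 with h | h
  · nlinarith
  · nlinarith

/-! ## §3. The YES-region: at or below the threshold the quadratic core stays in a ball -/

/-- **BELOW THE THRESHOLD THE CORE DOES NOT GROW**: `0 ≤ 2a + c ≤ 1`, `S_0 ≥ 0 ⟹ S_k ≤ S_0`. [folklore] -/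
theorem core_le_of_factor_le_one (hlam : ∀ k, lam (k + 1) = a * (2 * lam k + Lam k)) (hLam : ∀ k, Lam (k + 1) = c * (Lam k + 2 * lam k))
    (hρ0 : 0 ≤ 2 * a + c) (hρ1 : 2 * a + c ≤ 1) (hS0 : 0 ≤ 2 * lam 0 + Lam 0) : ∀ k : ℕ, 2 * lam k + Lam k ≤ 2 * lam 0 + Lam 0 := by
  intro k
  rw [core_closed_form hlam hLam k]
  have hp : (2 * a + c) ^ k ≤ 1 := pow_le_one₀ hρ0 hρ1
  nlinarith

/-- **AN INVARIANT BALL BELOW THE THRESHOLD**: `a, c ≥ 0`, `2a + c ≤ 1`, `λ_0, Λ_0 ≥ 0 ⟹ λ_k ≤ max(λ_0, a·S_0)` and `Λ_k ≤ max(Λ_0, c·S_0)`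
for all `k` (`S_0 = 2λ_0 + Λ_0`). [folklore] -/
theorem letters_bounded_of_factor_le_one (hlam : ∀ k, lam (k + 1) = a * (2 * lam k + Lam k))
    (hLam : ∀ k, Lam (k + 1) = c * (Lam k + 2 * lam k)) (ha : 0 ≤ a) (hc : 0 ≤ c) (hρ1 : 2 * a + c ≤ 1) (h0 : 0 ≤ lam 0) (h0' : 0 ≤ Lam 0) :
    ∀ k : ℕ, lam k ≤ max (lam 0) (a * (2 * lam 0 + Lam 0)) ∧ Lam k ≤ max (Lam 0) (c * (2 * lam 0 + Lam 0)) := by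
  intro k
  cases k with
  | zero => exact ⟨le_max_left _ _, le_max_left _ _⟩
  | succ k =>
    have hS := core_le_of_factor_le_one hlam hLam (by positivity) hρ1 (by positivity) k
    refine ⟨le_max_of_le_right ?_, le_max_of_le_right ?_⟩
    · rw [hlam k]; exact mul_le_mul_of_nonneg_left hS ha
    · rw [(succ_eq_factor_mul_core hlam hLam k).2]; exact mul_le_mul_of_nonneg_left hS hc

/-- **STRICTLY BELOW THE THRESHOLD THE CORE CONTRACTS TO ZERO**: `0 ≤ 2a + c < 1 ⟹ 2λ_k + Λ_k → 0`. [folklore] -/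
theorem core_tendsto_zero (hlam : ∀ k, lam (k + 1) = a * (2 * lam k + Lam k)) (hLam : ∀ k, Lam (k + 1) = c * (Lam k + 2 * lam k))
    (hρ0 : 0 ≤ 2 * a + c) (hρ1 : 2 * a + c < 1) : Tendsto (fun k : ℕ => 2 * lam k + Lam k) atTop (𝓝 0) := by
  have h := (tendsto_pow_atTop_nhds_zero_of_lt_one hρ0 hρ1).mul_const (2 * lam 0 + Lam 0)
  rw [zero_mul] at h
  refine h.congr fun k => ?_
  rw [core_closed_form hlam hLam k]

/-- **THE ADDITIVE (`κ₃`-TYPE) LETTER STAYS BOUNDED WHEN ITS SOURCE IS SUMMED**: `x_{k+1} ≤ θ·(x_k + q_k)` with `θ ≤ 1`, `x, q ≥ 0`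
gives `x_k ≤ x_0 + Σ_{j<k} q_j`. [folklore] -/
theorem additive_letter_bounded {x q : ℕ → ℝ} {θ : ℝ} (hθ1 : θ ≤ 1) (hx : ∀ k, 0 ≤ x k) (hq : ∀ k, 0 ≤ q k)
    (hrec : ∀ k, x (k + 1) ≤ θ * (x k + q k)) : ∀ k : ℕ, x k ≤ x 0 + ∑ j ∈ Finset.range k, q j := by
  intro k
  induction k with
  | zero => simp
  | succ k ih =>
    rw [Finset.sum_range_succ]
    have h1 := hrec k
    have h2 : θ * (x k + q k) ≤ 1 * (x k + q k) := mul_le_mul_of_nonneg_right hθ1 (by linarith [hx k, hq k])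
    linarith

/-! ## §4. The canonical verdict -/

/-- **AT CANONICAL SCALING THE FACTOR EXCEEDS ONE**: `0 ≤ a`, `c = L²`, `1 < L ⟹ 1 < 2a + c`. [folklore] -/
theorem canonical_factor_gt_one {L : ℝ} (ha : 0 ≤ a) (hc : c = L ^ 2) (hL : 1 < L) : 1 < 2 * a + c := by
  rw [hc]; nlinarith

/-- **THE FIXED-BALL TEST AT CANONICAL SCALING: NO.**  For the combined letter map with any `a = ‖A‖² ≥ 0` and the canonical block
transfer constant `c = L²` (file (429): `t²n = L²` in every dimension), `L > 1`, and nonnegative initial letters with `2λ_0 + Λ_0 > 0`,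
NO ball contains the letters `(λ_k, Λ_k)` of all steps. [folklore] -/
theorem canonical_no_invariant_ball {L : ℝ} (hlam : ∀ k, lam (k + 1) = a * (2 * lam k + Lam k))
    (hLam : ∀ k, Lam (k + 1) = c * (Lam k + 2 * lam k)) (ha : 0 ≤ a) (hc : c = L ^ 2) (hL : 1 < L) (hS0 : 0 < 2 * lam 0 + Lam 0) :
    ¬ ∃ B : ℝ, ∀ k : ℕ, lam k ≤ B ∧ Lam k ≤ B :=
  no_invariant_ball hlam hLam (canonical_factor_gt_one ha hc hL) hS0

/-- **THE FORMAT'S OWN LOSS, WITHOUT ANY BLOCKING**: `a = c = 1` (`L = 1`, `A = id`) still gives `2λ_k + Λ_k = 3^k(2λ_0 + Λ_0)` — two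
fluctuation half-steps cost `3×` what one full step costs: the nine-letter format is not a semigroup. [folklore] -/
theorem format_loss_without_blocking (hlam : ∀ k, lam (k + 1) = 1 * (2 * lam k + Lam k)) (hLam : ∀ k, Lam (k + 1) = 1 * (Lam k + 2 * lam k)) :
    ∀ k : ℕ, 2 * lam k + Lam k = 3 ^ k * (2 * lam 0 + Lam 0) := by
  intro k
  rw [core_closed_form hlam hLam k]
  norm_num

/-! ## §5. The YES-region never meets a coarse-graining -/

/-- **THE YES-REGION EXCLUDES EVERY COARSE-GRAINING**: `0 ≤ a`, `2a + c ≤ 1` forces `c ≤ 1`; with the canonical `c = L²` this is `L ≤ 1`. [folklore] -/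
theorem yes_region_excludes_canonical {L : ℝ} (ha : 0 ≤ a) (hρ1 : 2 * a + c ≤ 1) (hc : c = L ^ 2) (hL0 : 0 ≤ L) : L ≤ 1 := by
  rw [hc] at hρ1
  nlinarith

/-! ## §6. The field normalisation cancels in the next regulator -/

/-- **`t` IS A CHANGE OF UNITS**: the next step's regulator reads (rescaled stability letter) × (next covariance bound) =
`(t²·n·x)·(γ∕t²) = n·x·γ` — independent of the normalisation `t ≠ 0` of the coarse field; what the flow sees is the dimensionless
mass-type product, which the block size `n` and the physical covariance ratio move, not `t`. [folklore] -/
theorem regulator_product_t_free {t n x γ : ℝ} (ht : t ≠ 0) : (t ^ 2 * n * x) * (γ / t ^ 2) = n * x * γ := by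
  field_simp

/-! ## §7. Toy -/

/-- Toy (kernel): `L = 2`, `a = c = 4`: one step multiplies the core by `12`. -/
example (hlam : ∀ k, lam (k + 1) = 4 * (2 * lam k + Lam k)) (hLam : ∀ k, Lam (k + 1) = 4 * (Lam k + 2 * lam k)) :
    2 * lam 1 + Lam 1 = 12 * (2 * lam 0 + Lam 0) := by
  rw [core_succ hlam hLam 0]; norm_num

end Summit.QuantumFields.BalabanUV.T4Continuum.NE7b.SupBlockLetterMapFixedBall
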